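import Summits.QuantumFields.YangMills.Theorems.WeakCouplingRatesBulkDominatesColdBoxWDlrPlumbing

/-!
# Route `WeakCouplingRates`, one-scale assemblies (cruxes `BulkDominatesColdBoxW` stmt-QuantumFields-19609 and `ColdBoxTwoPointFloorW`): generic
# `β → ∞` bookkeeping — powers of the box side `2⌈β^θ⌉+3` against powers of `β`, and the large-field exponential against any power

Every step of the one-scale assembly with `H = ⌈β^θ⌉` ends in an inequality of the shape «constant × (2H+3)^k × β^a ≤ β^b for β ≥ β₀» (union bounds
over `≤ 120(2H+1)⁴` plaquettes, energies `16(2H+3)⁴β^{2δ−1}`, link sizes `(12H²+2H+1)·…`) or «constant × (2H+3)^k × e^{−β^ε} ≤ β^b».  This file proves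
them once, for all exponents:

* `natCeil_rpow_le_two_mul`, `two_mul_natCeil_add_three_le` — `⌈β^θ⌉ ≤ 2β^θ`, `2⌈β^θ⌉+3 ≤ 7β^θ` for `β ≥ 1`, `θ ≥ 0`;
* **`exists_const_mul_rpow_le_rpow`** — `a < b ⇒ ∃ β₀ ≥ 1, ∀ β ≥ β₀, C·β^a ≤ β^b`;
* **`exists_const_mul_boxSide_pow_mul_rpow_le`** — `kθ + a < b ⇒ ∃ β₀ ≥ 1, ∀ β ≥ β₀, C·(2⌈β^θ⌉+3)^k·β^a ≤ β^b`;
* **`exists_const_mul_rpow_mul_exp_neg_le`**, **`exists_const_mul_boxSide_pow_mul_exp_neg_le`** — `C·β^a·e^{−β^ε} ≤ β^b` and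
  `C·(2⌈β^θ⌉+3)^k·e^{−β^ε} ≤ β^b` eventually, for every `a, b, θ` and `ε > 0` (from `tendsto_rpow_mul_exp_neg_rpow`).

Fleet seat `ym-spine-20043-p1` (g3).  No sorry, standard axioms, no new definition, no named-fact hypothesis.  NOT a claim about the mass gap.
-/

set_option autoImplicit false

noncomputable section

open Filter Topology Real

namespace Summit.QuantumFields.YangMills.Theorems.WeakCouplingRates

/-! ## The box side against `β^θ` -/

/-- `⌈β^θ⌉ ≤ 2β^θ` for `β ≥ 1`, `θ ≥ 0`. -/
theorem natCeil_rpow_le_two_mul {β θ : ℝ} (hβ : 1 ≤ β) (hθ : 0 ≤ θ) : (⌈β ^ θ⌉₊ : ℝ) ≤ 2 * β ^ θ := by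
  have h1 : 1 ≤ β ^ θ := Real.one_le_rpow hβ hθ
  have h2 : (⌈β ^ θ⌉₊ : ℝ) < β ^ θ + 1 := Nat.ceil_lt_add_one (by linarith)
  linarith

/-- `2⌈β^θ⌉ + 3 ≤ 7β^θ` for `β ≥ 1`, `θ ≥ 0`. -/
theorem two_mul_natCeil_add_three_le {β θ : ℝ} (hβ : 1 ≤ β) (hθ : 0 ≤ θ) : 2 * (⌈β ^ θ⌉₊ : ℝ) + 3 ≤ 7 * β ^ θ := by
  have h1 : 1 ≤ β ^ θ := Real.one_le_rpow hβ hθ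
  have h2 := natCeil_rpow_le_two_mul hβ hθ
  linarith

/-- `(2⌈β^θ⌉ + 3)^k ≤ 7^k · β^{kθ}` for `β ≥ 1`, `θ ≥ 0`. -/
theorem boxSide_pow_le {β θ : ℝ} (hβ : 1 ≤ β) (hθ : 0 ≤ θ) (k : ℕ) :
    (2 * (⌈β ^ θ⌉₊ : ℝ) + 3) ^ k ≤ 7 ^ k * β ^ ((k : ℝ) * θ) := by
  have hβ0 : 0 < β := by linarith
  calc (2 * (⌈β ^ θ⌉₊ : ℝ) + 3) ^ k ≤ (7 * β ^ θ) ^ k := pow_le_pow_left₀ (by positivity) (two_mul_natCeil_add_three_le hβ hθ) k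
    _ = 7 ^ k * (β ^ θ) ^ k := mul_pow _ _ _
    _ = 7 ^ k * β ^ ((k : ℝ) * θ) := by rw [show ((k : ℝ) * θ) = θ * k by ring, Real.rpow_mul hβ0.le, Real.rpow_natCast]

/-! ## Powers against powers -/

/-- **`C·β^a ≤ β^b` eventually, for `a < b`.** -/
theorem exists_const_mul_rpow_le_rpow (C : ℝ) {a b : ℝ} (hab : a < b) :
    ∃ β₀ : ℝ, 1 ≤ β₀ ∧ ∀ β : ℝ, β₀ ≤ β → C * β ^ a ≤ β ^ b := by
  have hgap : 0 < b - a := by linarith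
  have hev : ∀ᶠ β : ℝ in atTop, C ≤ β ^ (b - a) := (tendsto_rpow_atTop hgap).eventually_ge_atTop C
  obtain ⟨β₁, hβ₁⟩ := Filter.eventually_atTop.1 hev
  refine ⟨max β₁ 1, le_max_right _ _, fun β hβ => ?_⟩
  have hβ1 : 1 ≤ β := (le_max_right _ _).trans hβ
  have hβ0 : 0 < β := by linarith
  have hC : C ≤ β ^ (b - a) := hβ₁ β ((le_max_left _ _).trans hβ)
  have hsplit : β ^ b = β ^ (b - a) * β ^ a := by rw [← Real.rpow_add hβ0]; ring_nf
  rw [hsplit]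
  exact mul_le_mul_of_nonneg_right hC (Real.rpow_nonneg hβ0.le a)

/-- **`C·(2⌈β^θ⌉+3)^k·β^a ≤ β^b` eventually, for `kθ + a < b`** (`θ > 0`). -/
theorem exists_const_mul_boxSide_pow_mul_rpow_le (C : ℝ) (k : ℕ) {θ a b : ℝ} (hθ : 0 < θ) (h : (k : ℝ) * θ + a < b) :
    ∃ β₀ : ℝ, 1 ≤ β₀ ∧ ∀ β : ℝ, β₀ ≤ β → C * (2 * (⌈β ^ θ⌉₊ : ℝ) + 3) ^ k * β ^ a ≤ β ^ b := by
  obtain ⟨β₀, hβ₀1, hβ₀⟩ := exists_const_mul_rpow_le_rpow (max C 0 * 7 ^ k) h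
  refine ⟨β₀, hβ₀1, fun β hβ => ?_⟩
  have hβ1 : 1 ≤ β := hβ₀1.trans hβ
  have hβ0 : 0 < β := by linarith
  have hside := boxSide_pow_le hβ1 hθ.le k
  have hside0 : 0 ≤ (2 * (⌈β ^ θ⌉₊ : ℝ) + 3) ^ k := by positivity
  have hmain := hβ₀ β hβ
  rw [Real.rpow_add hβ0, ← mul_assoc] at hmain
  have ha0 : 0 ≤ β ^ a := Real.rpow_nonneg hβ0.le a
  have hC0 : 0 ≤ max C 0 := le_max_right _ _
  calc C * (2 * (⌈β ^ θ⌉₊ : ℝ) + 3) ^ k * β ^ a ≤ max C 0 * (2 * (⌈β ^ θ⌉₊ : ℝ) + 3) ^ k * β ^ a :=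
        mul_le_mul_of_nonneg_right (mul_le_mul_of_nonneg_right (le_max_left _ _) hside0) ha0
    _ ≤ max C 0 * (7 ^ k * β ^ ((k : ℝ) * θ)) * β ^ a :=
        mul_le_mul_of_nonneg_right (mul_le_mul_of_nonneg_left hside hC0) ha0
    _ = max C 0 * 7 ^ k * β ^ ((k : ℝ) * θ) * β ^ a := by ring
    _ ≤ β ^ b := hmain

/-! ## The large-field exponential against powers -/

/-- **`C·β^a·e^{−β^ε} ≤ β^b` eventually**, for every `a, b` and `ε > 0`. -/
theorem exists_const_mul_rpow_mul_exp_neg_le (C a b : ℝ) {ε : ℝ} (hε : 0 < ε) :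
    ∃ β₀ : ℝ, 1 ≤ β₀ ∧ ∀ β : ℝ, β₀ ≤ β → C * β ^ a * Real.exp (-(β ^ ε)) ≤ β ^ b := by
  have ht := (tendsto_rpow_mul_exp_neg_rpow (a - b) hε).const_mul (max C 0)
  rw [mul_zero] at ht
  have hev : ∀ᶠ β : ℝ in atTop, max C 0 * (β ^ (a - b) * Real.exp (-(β ^ ε))) ≤ 1 :=
    (ht.eventually (ge_mem_nhds one_pos))
  obtain ⟨β₁, hβ₁⟩ := Filter.eventually_atTop.1 hev
  refine ⟨max β₁ 1, le_max_right _ _, fun β hβ => ?_⟩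
  have hβ1 : 1 ≤ β := (le_max_right _ _).trans hβ
  have hβ0 : 0 < β := by linarith
  have h1 : max C 0 * (β ^ (a - b) * Real.exp (-(β ^ ε))) ≤ 1 := hβ₁ β ((le_max_left _ _).trans hβ)
  have hb0 : 0 < β ^ b := Real.rpow_pos_of_pos hβ0 b
  have hsplit : β ^ a = β ^ (a - b) * β ^ b := by rw [← Real.rpow_add hβ0]; ring_nf
  have ha0 : 0 ≤ β ^ a := Real.rpow_nonneg hβ0.le a
  have he0 : 0 ≤ Real.exp (-(β ^ ε)) := (Real.exp_pos _).le
  calc C * β ^ a * Real.exp (-(β ^ ε)) ≤ max C 0 * β ^ a * Real.exp (-(β ^ ε)) :=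
        mul_le_mul_of_nonneg_right (mul_le_mul_of_nonneg_right (le_max_left _ _) ha0) he0
    _ = (max C 0 * (β ^ (a - b) * Real.exp (-(β ^ ε)))) * β ^ b := by rw [hsplit]; ring
    _ ≤ 1 * β ^ b := mul_le_mul_of_nonneg_right h1 hb0.le
    _ = β ^ b := one_mul _

/-- **`C·(2⌈β^θ⌉+3)^k·e^{−β^ε} ≤ β^b` eventually**, for every `k, θ ≥ 0, b` and `ε > 0`. -/
theorem exists_const_mul_boxSide_pow_mul_exp_neg_le (C : ℝ) (k : ℕ) {θ ε : ℝ} (hθ : 0 ≤ θ) (hε : 0 < ε) (b : ℝ) :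
    ∃ β₀ : ℝ, 1 ≤ β₀ ∧ ∀ β : ℝ, β₀ ≤ β → C * (2 * (⌈β ^ θ⌉₊ : ℝ) + 3) ^ k * Real.exp (-(β ^ ε)) ≤ β ^ b := by
  obtain ⟨β₀, hβ₀1, hβ₀⟩ := exists_const_mul_rpow_mul_exp_neg_le (max C 0 * 7 ^ k) ((k : ℝ) * θ) b hε
  refine ⟨β₀, hβ₀1, fun β hβ => ?_⟩
  have hβ1 : 1 ≤ β := hβ₀1.trans hβ
  have hside := boxSide_pow_le hβ1 hθ k
  have hexp0 : 0 ≤ Real.exp (-(β ^ ε)) := (Real.exp_pos _).le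
  have hside0 : 0 ≤ (2 * (⌈β ^ θ⌉₊ : ℝ) + 3) ^ k := by positivity
  have hC0 : 0 ≤ max C 0 := le_max_right _ _
  calc C * (2 * (⌈β ^ θ⌉₊ : ℝ) + 3) ^ k * Real.exp (-(β ^ ε))
      ≤ max C 0 * (2 * (⌈β ^ θ⌉₊ : ℝ) + 3) ^ k * Real.exp (-(β ^ ε)) :=
        mul_le_mul_of_nonneg_right (mul_le_mul_of_nonneg_right (le_max_left _ _) hside0) hexp0
    _ ≤ max C 0 * (7 ^ k * β ^ ((k : ℝ) * θ)) * Real.exp (-(β ^ ε)) :=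
        mul_le_mul_of_nonneg_right (mul_le_mul_of_nonneg_left hside hC0) hexp0
    _ = max C 0 * 7 ^ k * β ^ ((k : ℝ) * θ) * Real.exp (-(β ^ ε)) := by ring
    _ ≤ β ^ b := hβ₀ β hβ

/-- Two thresholds at once: the maximum of two admissible `β₀`'s is admissible for both (bookkeeping convenience). -/
theorem forall_ge_max_of_forall_ge {P Q : ℝ → Prop} {β₁ β₂ : ℝ} (h₁ : ∀ β, β₁ ≤ β → P β) (h₂ : ∀ β, β₂ ≤ β → Q β) :
    ∀ β, max β₁ β₂ ≤ β → P β ∧ Q β :=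
  fun β hβ => ⟨h₁ β ((le_max_left _ _).trans hβ), h₂ β ((le_max_right _ _).trans hβ)⟩

end Summit.QuantumFields.YangMills.Theorems.WeakCouplingRates

end
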